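import Mathlib.ModelTheory.Basic
import Mathlib.Data.Fin.VecNotation
import Mathlib.Tactic.FinCases
import HarnessLib

/-!
# The homomorphism OR-construction of CSP templates (Lichter–Pago 2025, §3)

Topic `Literature/ModelTheory/FiniteModelTheory`.  Source: M. Lichter, B. Pago, *Limitations of
Affine Integer Relaxations for Solving Constraint Satisfaction Problems*, ICALP 2025 =
arXiv:2407.09097 (v3), §3 (the generic OR-construction `𝔸(𝔸₁,𝔸₂,W₁,W₂)`, `𝔹(𝔹₁,𝔹₂)`,
Lemma 3.1) and §3.2 (the INTRACTABLE variant `OR_⊥(𝔸₁,𝔸₂) := 𝔸(𝔸₁,𝔸₂,A₁,A₂)`, used in the proof of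
Theorem 5.9).

## Content (Mathlib first-order structures)

* `orLanguage L₁ L₂` — the vocabulary `σ = σ₁ ⊎ σ₂ ⊎ {S}` with a fresh binary symbol `S`
  (`OrRel.link`), relational.
* `OrTemplate A₁ A₂` (universe `A₁ ⊎ A₂ ⊎ {c₁, c₂}`, rendered `Option A₁ ⊕ Option A₂` with
  `none` = the fresh vertex `c_i`) with the structure of `OR_⊥(𝔸₁, 𝔸₂)`:
  `R^𝔸 = R^{𝔸_i} ∪ {c_i}^{ar R} ∪ W_i^{ar R, c_i}` with `W_i = A_i`, i.e. a `σ_i`-tuple holds iff it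
  lies in part `i` and is all-`c_i`, or contains `c_i`, or is an `R^{𝔸_i}`-tuple;
  `S^𝔸 = (A₁ × (A₂ ∪ {c₂})) ∪ ((A₁ ∪ {c₁}) × A₂)`.
* `OrInstance B₁ B₂` (universe `B₁ ⊎ B₂`) with the structure of `𝔹(𝔹₁, 𝔹₂)`:
  `R^𝔹 = R^{𝔹_i}`, `S^𝔹 = B₁ × B₂`.
* `OrInstance.hom_iff` — Lemma 3.1: `𝔹(𝔹₁,𝔹₂) → OR_⊥(𝔸₁,𝔸₂)` iff `𝔹₁ → 𝔸₁` or `𝔹₂ → 𝔸₂`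
  (for vocabularies without `0`-ary symbols, as CSP templates are; the printed proof uses this
  tacitly when it says that an `A_i`-valued tuple of `R^𝔸` lies in `R^{𝔸_i}`).

The sequel `OrConstructionObstruction.lean` proves that these instances are REJECTED by
Ó Conghaile's cohomological `k`-consistency algorithm when both `𝔹_i` are no-instances of abelian
coset templates — contrary to the use made of them in the proof of [LP25, Thm 5.9].

## What is NOT here

The tractable variant `OR_T` (`W_i = ∅`, §3.1), Lemmas 3.2–3.7 on partial homomorphisms and
solutions of the width-`k` relaxation, NP-completeness of `CSP(OR_⊥(·,·))` (Lemmas 3.18–3.19).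
-/

namespace Literature.ModelTheory.FiniteModelTheory

open FirstOrder FirstOrder.Language FirstOrder.Language.Structure

universe u v u' v' w₁ w₂ w₃ w₄

section OrConstruction

variable (L₁ : Language.{u, v}) (L₂ : Language.{u', v'})

/-- The relation symbols of the vocabulary `σ₁ ⊎ σ₂ ⊎ {S}` of the OR-construction: those of `σ₁`,
those of `σ₂`, and a fresh binary symbol `S` (`link`). [cite: LichterPago2025, §3] -/
inductive OrRel : ℕ → Type (max v v')
  | inl {n : ℕ} (r : L₁.Relations n) : OrRel n
  | inr {n : ℕ} (r : L₂.Relations n) : OrRel n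
  | link : OrRel 2

/-- The vocabulary `σ = σ₁ ⊎ σ₂ ⊎ {S}` of the OR-construction (relational: no function symbols).
[cite: LichterPago2025, §3] -/
def orLanguage : Language := ⟨fun _ => Empty, OrRel L₁ L₂⟩

/-- The OR-vocabulary is relational. [cite: LichterPago2025, §3] -/
instance : (orLanguage L₁ L₂).IsRelational := fun _ => Empty.instIsEmpty

variable {L₁ L₂}

/-- The universe `A₁ ⊎ A₂ ⊎ {c₁, c₂}` of the OR-template: `inl none` is the fresh vertex `c₁`,
`inr none` is `c₂`, `inl (some a)` / `inr (some a)` are the elements of `A₁` / `A₂`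
(`OrTemplate.inl`, `OrTemplate.inr` below).
[cite: LichterPago2025, §3] -/
def OrTemplate (A₁ : Type w₁) (A₂ : Type w₂) : Type (max w₁ w₂) := Option A₁ ⊕ Option A₂

/-- The universe `B₁ ⊎ B₂` of the OR-instance `𝔹(𝔹₁, 𝔹₂)`. [cite: LichterPago2025, §3] -/
def OrInstance (B₁ : Type w₃) (B₂ : Type w₄) : Type (max w₃ w₄) := B₁ ⊕ B₂

/-- Equality on `B₁ ⊎ B₂` is decidable when it is on the parts (needed for contexts = finsets).
[folklore] -/
instance {B₁ : Type w₃} {B₂ : Type w₄} [DecidableEq B₁] [DecidableEq B₂] :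
    DecidableEq (OrInstance B₁ B₂) :=
  inferInstanceAs (DecidableEq (B₁ ⊕ B₂))

namespace OrTemplate

variable {A₁ : Type w₁} {A₂ : Type w₂}

/-- Part 1 of the OR-template: `inl (some a)` is `a ∈ A₁`, `inl none` is `c₁`.
[cite: LichterPago2025, §3] -/
def inl (o : Option A₁) : OrTemplate A₁ A₂ := Sum.inl o

/-- Part 2 of the OR-template: `inr (some a)` is `a ∈ A₂`, `inr none` is `c₂`.
[cite: LichterPago2025, §3] -/
def inr (o : Option A₂) : OrTemplate A₁ A₂ := Sum.inr o

/-- `inl` is injective. [folklore] -/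
@[simp] theorem inl_inj {o o' : Option A₁} : (inl o : OrTemplate A₁ A₂) = inl o' ↔ o = o' :=
  Sum.inl_injective.eq_iff

/-- `inr` is injective. [folklore] -/
@[simp] theorem inr_inj {o o' : Option A₂} : (inr o : OrTemplate A₁ A₂) = inr o' ↔ o = o' :=
  Sum.inr_injective.eq_iff

/-- The two parts are disjoint. [folklore] -/
@[simp] theorem inl_ne_inr {o : Option A₁} {o' : Option A₂} : (inl o : OrTemplate A₁ A₂) ≠ inr o' :=
  Sum.inl_ne_inr

/-- The two parts are disjoint. [folklore] -/
@[simp] theorem inr_ne_inl {o : Option A₂} {o' : Option A₁} : (inr o : OrTemplate A₁ A₂) ≠ inl o' :=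
  Sum.inr_ne_inl

end OrTemplate

namespace OrInstance

variable {B₁ : Type w₃} {B₂ : Type w₄}

/-- Part 1 of the OR-instance. [cite: LichterPago2025, §3] -/
def inl (b : B₁) : OrInstance B₁ B₂ := Sum.inl b

/-- Part 2 of the OR-instance. [cite: LichterPago2025, §3] -/
def inr (b : B₂) : OrInstance B₁ B₂ := Sum.inr b

/-- `inl` is injective. [folklore] -/
@[simp] theorem inl_inj {b b' : B₁} : (inl b : OrInstance B₁ B₂) = inl b' ↔ b = b' :=
  Sum.inl_injective.eq_iff

/-- `inr` is injective. [folklore] -/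
@[simp] theorem inr_inj {b b' : B₂} : (inr b : OrInstance B₁ B₂) = inr b' ↔ b = b' :=
  Sum.inr_injective.eq_iff

/-- The two parts are disjoint. [folklore] -/
@[simp] theorem inl_ne_inr {b : B₁} {b' : B₂} : (inl b : OrInstance B₁ B₂) ≠ inr b' :=
  Sum.inl_ne_inr

/-- The two parts are disjoint. [folklore] -/
@[simp] theorem inr_ne_inl {b : B₂} {b' : B₁} : (inr b : OrInstance B₁ B₂) ≠ inl b' :=
  Sum.inr_ne_inl

/-- Definition by cases on the two parts of the OR-instance. [folklore] -/
protected def elim {X : Sort*} (f : B₁ → X) (g : B₂ → X) : OrInstance B₁ B₂ → X := Sum.elim f g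

/-- Computation rule of `OrInstance.elim` on part 1. [folklore] -/
@[simp] theorem elim_inl {X : Sort*} (f : B₁ → X) (g : B₂ → X) (b : B₁) :
    OrInstance.elim f g (inl b) = f b := rfl

/-- Computation rule of `OrInstance.elim` on part 2. [folklore] -/
@[simp] theorem elim_inr {X : Sort*} (f : B₁ → X) (g : B₂ → X) (b : B₂) :
    OrInstance.elim f g (inr b) = g b := rfl

end OrInstance

section Template

variable (A₁ : Type w₁) (A₂ : Type w₂) [L₁.Structure A₁] [L₂.Structure A₂]

/-- **The intractable OR-template `OR_⊥(𝔸₁, 𝔸₂)`** (the OR-construction with `W₁ = A₁`, `W₂ = A₂`):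
for `R ∈ σ_i`, `R^𝔸 = R^{𝔸_i} ∪ {c_i}^{ar R} ∪ W_i^{ar R, c_i}`, i.e. a part-`i` tuple that is
all-`c_i` (this includes the empty tuple when `ar R = 0`), or contains `c_i`, or is an
`R^{𝔸_i}`-tuple; and `S^𝔸 = (A₁ × (A₂ ∪ {c₂})) ∪ ((A₁ ∪ {c₁}) × A₂)`.
[cite: LichterPago2025, §3 and §3.2] -/
instance orTemplateStructure : (orLanguage L₁ L₂).Structure (OrTemplate A₁ A₂) where
  RelMap := fun {n} r x =>
    match n, r, x with
    | n, OrRel.inl r, x => ∃ y : Fin n → Option A₁, (∀ i, x i = OrTemplate.inl (y i)) ∧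
        ((∀ i, y i = none) ∨ (∃ i, y i = none) ∨
          ∃ z : Fin n → A₁, (∀ i, y i = some (z i)) ∧ RelMap r z)
    | n, OrRel.inr r, x => ∃ y : Fin n → Option A₂, (∀ i, x i = OrTemplate.inr (y i)) ∧
        ((∀ i, y i = none) ∨ (∃ i, y i = none) ∨
          ∃ z : Fin n → A₂, (∀ i, y i = some (z i)) ∧ RelMap r z)
    | _, OrRel.link, x =>
        (∃ (a : A₁) (o : Option A₂), x 0 = OrTemplate.inl (some a) ∧ x 1 = OrTemplate.inr o) ∨
          ∃ (o : Option A₁) (a : A₂), x 0 = OrTemplate.inl o ∧ x 1 = OrTemplate.inr (some a)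

variable {A₁ A₂}

/-- Unfolding the interpretation of a `σ₁`-symbol in `OR_⊥(𝔸₁, 𝔸₂)`. [cite: LichterPago2025, §3] -/
theorem OrTemplate.relMap_inl {n : ℕ} (r : L₁.Relations n) (x : Fin n → OrTemplate A₁ A₂) :
    RelMap (L := orLanguage L₁ L₂) (OrRel.inl r) x ↔ ∃ y : Fin n → Option A₁,
      (∀ i, x i = OrTemplate.inl (y i)) ∧ ((∀ i, y i = none) ∨ (∃ i, y i = none) ∨
        ∃ z : Fin n → A₁, (∀ i, y i = some (z i)) ∧ RelMap r z) :=
  Iff.rfl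

/-- Unfolding the interpretation of a `σ₂`-symbol in `OR_⊥(𝔸₁, 𝔸₂)`. [cite: LichterPago2025, §3] -/
theorem OrTemplate.relMap_inr {n : ℕ} (r : L₂.Relations n) (x : Fin n → OrTemplate A₁ A₂) :
    RelMap (L := orLanguage L₁ L₂) (OrRel.inr r) x ↔ ∃ y : Fin n → Option A₂,
      (∀ i, x i = OrTemplate.inr (y i)) ∧ ((∀ i, y i = none) ∨ (∃ i, y i = none) ∨
        ∃ z : Fin n → A₂, (∀ i, y i = some (z i)) ∧ RelMap r z) :=
  Iff.rfl

/-- Unfolding the interpretation of `S` in `OR_⊥(𝔸₁, 𝔸₂)`: first coordinate in part 1, second in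
part 2, not both fresh. [cite: LichterPago2025, §3] -/
theorem OrTemplate.relMap_link (x : Fin 2 → OrTemplate A₁ A₂) :
    RelMap (L := orLanguage L₁ L₂) (OrRel.link (L₁ := L₁) (L₂ := L₂)) x ↔
      (∃ (a : A₁) (o : Option A₂), x 0 = OrTemplate.inl (some a) ∧ x 1 = OrTemplate.inr o) ∨
        ∃ (o : Option A₁) (a : A₂), x 0 = OrTemplate.inl o ∧ x 1 = OrTemplate.inr (some a) :=
  Iff.rfl

/-- An `A₂`-valued tuple of `R^𝔸`, `R ∈ σ₂` of positive arity, is an `R^{𝔸₂}`-tuple.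
[cite: LichterPago2025, §3 (proof of Lemma 3.1)] -/
theorem OrTemplate.relMap_of_relMap_inr_some [IsEmpty (L₂.Relations 0)] {n : ℕ}
    (r : L₂.Relations n) (z : Fin n → A₂)
    (h : RelMap (L := orLanguage L₁ L₂) (OrRel.inr (L₁ := L₁) r)
      (fun i => (OrTemplate.inr (some (z i)) : OrTemplate A₁ A₂))) :
    RelMap r z := by
  obtain ⟨y, hy, hcases⟩ := (OrTemplate.relMap_inr r _).1 h
  have hyz : ∀ i, y i = some (z i) := fun i => (OrTemplate.inr_inj.1 (hy i)).symm
  rcases hcases with hall | ⟨i, hi⟩ | ⟨z', hz', hr⟩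
  · cases n with
    | zero => exact isEmptyElim r
    | succ n => exact absurd ((hyz 0).symm.trans (hall 0)) (by simp)
  · exact absurd ((hyz i).symm.trans hi) (by simp)
  · have : z' = z := funext fun i => Option.some_injective _ ((hz' i).symm.trans (hyz i))
    exact this ▸ hr

/-- An `A₁`-valued tuple of `R^𝔸`, `R ∈ σ₁` of positive arity, is an `R^{𝔸₁}`-tuple.
[cite: LichterPago2025, §3 (proof of Lemma 3.1)] -/
theorem OrTemplate.relMap_of_relMap_inl_some [IsEmpty (L₁.Relations 0)] {n : ℕ}
    (r : L₁.Relations n) (z : Fin n → A₁)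
    (h : RelMap (L := orLanguage L₁ L₂) (OrRel.inl (L₂ := L₂) r)
      (fun i => (OrTemplate.inl (some (z i)) : OrTemplate A₁ A₂))) :
    RelMap r z := by
  obtain ⟨y, hy, hcases⟩ := (OrTemplate.relMap_inl r _).1 h
  have hyz : ∀ i, y i = some (z i) := fun i => (OrTemplate.inl_inj.1 (hy i)).symm
  rcases hcases with hall | ⟨i, hi⟩ | ⟨z', hz', hr⟩
  · cases n with
    | zero => exact isEmptyElim r
    | succ n => exact absurd ((hyz 0).symm.trans (hall 0)) (by simp)
  · exact absurd ((hyz i).symm.trans hi) (by simp)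
  · have : z' = z := funext fun i => Option.some_injective _ ((hz' i).symm.trans (hyz i))
    exact this ▸ hr

end Template

section Instance

variable (B₁ : Type w₃) (B₂ : Type w₄) [L₁.Structure B₁] [L₂.Structure B₂]

/-- **The OR-instance `𝔹(𝔹₁, 𝔹₂)`**: `R^𝔹 = R^{𝔹_i}` for `R ∈ σ_i`, and `S^𝔹 = B₁ × B₂`.
[cite: LichterPago2025, §3] -/
instance orInstanceStructure : (orLanguage L₁ L₂).Structure (OrInstance B₁ B₂) where
  RelMap := fun {n} r x =>
    match n, r, x with
    | n, OrRel.inl r, x => ∃ y : Fin n → B₁, (∀ i, x i = OrInstance.inl (y i)) ∧ RelMap r y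
    | n, OrRel.inr r, x => ∃ y : Fin n → B₂, (∀ i, x i = OrInstance.inr (y i)) ∧ RelMap r y
    | _, OrRel.link, x => ∃ (b₁ : B₁) (b₂ : B₂), x 0 = OrInstance.inl b₁ ∧ x 1 = OrInstance.inr b₂

variable {B₁ B₂}

/-- Unfolding the interpretation of a `σ₁`-symbol in `𝔹(𝔹₁, 𝔹₂)`. [cite: LichterPago2025, §3] -/
theorem OrInstance.relMap_inl {n : ℕ} (r : L₁.Relations n) (x : Fin n → OrInstance B₁ B₂) :
    RelMap (L := orLanguage L₁ L₂) (OrRel.inl r) x ↔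
      ∃ y : Fin n → B₁, (∀ i, x i = OrInstance.inl (y i)) ∧ RelMap r y :=
  Iff.rfl

/-- Unfolding the interpretation of a `σ₂`-symbol in `𝔹(𝔹₁, 𝔹₂)`. [cite: LichterPago2025, §3] -/
theorem OrInstance.relMap_inr {n : ℕ} (r : L₂.Relations n) (x : Fin n → OrInstance B₁ B₂) :
    RelMap (L := orLanguage L₁ L₂) (OrRel.inr r) x ↔
      ∃ y : Fin n → B₂, (∀ i, x i = OrInstance.inr (y i)) ∧ RelMap r y :=
  Iff.rfl

/-- Unfolding the interpretation of `S` in `𝔹(𝔹₁, 𝔹₂)`: all of `B₁ × B₂`.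
[cite: LichterPago2025, §3] -/
theorem OrInstance.relMap_link (x : Fin 2 → OrInstance B₁ B₂) :
    RelMap (L := orLanguage L₁ L₂) (OrRel.link (L₁ := L₁) (L₂ := L₂)) x ↔
      ∃ (b₁ : B₁) (b₂ : B₂), x 0 = OrInstance.inl b₁ ∧ x 1 = OrInstance.inr b₂ :=
  Iff.rfl

/-- Every pair `(b₁, b₂)` is an `S`-edge of `𝔹(𝔹₁, 𝔹₂)`. [cite: LichterPago2025, §3] -/
theorem OrInstance.relMap_link_pair (b₁ : B₁) (b₂ : B₂) :
    RelMap (L := orLanguage L₁ L₂) (OrRel.link (L₁ := L₁) (L₂ := L₂))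
      ![(OrInstance.inl b₁ : OrInstance B₁ B₂), OrInstance.inr b₂] :=
  (OrInstance.relMap_link _).2 ⟨b₁, b₂, rfl, rfl⟩

/-- A tuple of `R^{𝔹₂}` is a tuple of `R^𝔹`. [cite: LichterPago2025, §3] -/
theorem OrInstance.relMap_inr_of {n : ℕ} (r : L₂.Relations n) {y : Fin n → B₂} (h : RelMap r y) :
    RelMap (L := orLanguage L₁ L₂) (OrRel.inr (L₁ := L₁) r)
      (fun i => (OrInstance.inr (y i) : OrInstance B₁ B₂)) :=
  (OrInstance.relMap_inr r _).2 ⟨y, fun _ => rfl, h⟩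

/-- A tuple of `R^{𝔹₁}` is a tuple of `R^𝔹`. [cite: LichterPago2025, §3] -/
theorem OrInstance.relMap_inl_of {n : ℕ} (r : L₁.Relations n) {y : Fin n → B₁} (h : RelMap r y) :
    RelMap (L := orLanguage L₁ L₂) (OrRel.inl (L₂ := L₂) r)
      (fun i => (OrInstance.inl (y i) : OrInstance B₁ B₂)) :=
  (OrInstance.relMap_inl r _).2 ⟨y, fun _ => rfl, h⟩

end Instance

/-! ### Lemma 3.1: the construction realises the disjunction -/

section Correctness

variable {A₁ : Type w₁} {A₂ : Type w₂} [L₁.Structure A₁] [L₂.Structure A₂]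
variable {B₁ : Type w₃} {B₂ : Type w₄} [L₁.Structure B₁] [L₂.Structure B₂]

/-- Lemma 3.1, direction `⇐`, first disjunct: a homomorphism `𝔹₁ → 𝔸₁` extends to
`𝔹(𝔹₁,𝔹₂) → OR_⊥(𝔸₁,𝔸₂)` by sending all of `B₂` to `c₂`. [cite: LichterPago2025, Lemma 3.1] -/
theorem OrInstance.hom_of_left (f : B₁ →[L₁] A₁) :
    Nonempty (OrInstance B₁ B₂ →[orLanguage L₁ L₂] OrTemplate A₁ A₂) := by
  refine ⟨⟨OrInstance.elim (fun b => OrTemplate.inl (some (f b))) (fun _ => OrTemplate.inr none),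
    fun {n} g => Empty.elim g, ?_⟩⟩
  intro n r x hx
  match n, r, x, hx with
  | n, OrRel.inl r, x, hx =>
    obtain ⟨y, hy, hr⟩ := (OrInstance.relMap_inl r x).1 hx
    refine (OrTemplate.relMap_inl r _).2 ⟨fun i => some (f (y i)), fun i => ?_, Or.inr (Or.inr
      ⟨fun i => f (y i), fun _ => rfl, f.map_rel r y hr⟩)⟩
    simp [Function.comp, hy i]
  | n, OrRel.inr r, x, hx =>
    obtain ⟨y, hy, -⟩ := (OrInstance.relMap_inr r x).1 hx
    refine (OrTemplate.relMap_inr r _).2 ⟨fun _ => none, fun i => ?_, Or.inl fun _ => rfl⟩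
    simp [Function.comp, hy i]
  | _, OrRel.link, x, hx =>
    obtain ⟨b₁, b₂, h0, h1⟩ := (OrInstance.relMap_link x).1 hx
    exact (OrTemplate.relMap_link _).2 (Or.inl ⟨f b₁, none, by simp [Function.comp, h0],
      by simp [Function.comp, h1]⟩)

/-- Lemma 3.1, direction `⇐`, second disjunct: a homomorphism `𝔹₂ → 𝔸₂` extends to
`𝔹(𝔹₁,𝔹₂) → OR_⊥(𝔸₁,𝔸₂)` by sending all of `B₁` to `c₁`. [cite: LichterPago2025, Lemma 3.1] -/
theorem OrInstance.hom_of_right (f : B₂ →[L₂] A₂) :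
    Nonempty (OrInstance B₁ B₂ →[orLanguage L₁ L₂] OrTemplate A₁ A₂) := by
  refine ⟨⟨OrInstance.elim (fun _ => OrTemplate.inl none) (fun b => OrTemplate.inr (some (f b))),
    fun {n} g => Empty.elim g, ?_⟩⟩
  intro n r x hx
  match n, r, x, hx with
  | n, OrRel.inl r, x, hx =>
    obtain ⟨y, hy, -⟩ := (OrInstance.relMap_inl r x).1 hx
    refine (OrTemplate.relMap_inl r _).2 ⟨fun _ => none, fun i => ?_, Or.inl fun _ => rfl⟩
    simp [Function.comp, hy i]
  | n, OrRel.inr r, x, hx =>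
    obtain ⟨y, hy, hr⟩ := (OrInstance.relMap_inr r x).1 hx
    refine (OrTemplate.relMap_inr r _).2 ⟨fun i => some (f (y i)), fun i => ?_, Or.inr (Or.inr
      ⟨fun i => f (y i), fun _ => rfl, f.map_rel r y hr⟩)⟩
    simp [Function.comp, hy i]
  | _, OrRel.link, x, hx =>
    obtain ⟨b₁, b₂, h0, h1⟩ := (OrInstance.relMap_link x).1 hx
    exact (OrTemplate.relMap_link _).2 (Or.inr ⟨none, f b₂, by simp [Function.comp, h0],
      by simp [Function.comp, h1]⟩)

/-- Lemma 3.1, direction `⇒`: a homomorphism `𝔹(𝔹₁,𝔹₂) → OR_⊥(𝔸₁,𝔸₂)` either avoids `c₁` on `B₁`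
(and then restricts to `𝔹₁ → 𝔸₁`, the `S`-edges to a point of `B₂` keeping `B₁` inside part 1)
or hits `c₁`, and then the `S`-edges force all of `B₂` into `A₂` (giving `𝔹₂ → 𝔸₂`).  Vocabularies
without `0`-ary symbols. [cite: LichterPago2025, Lemma 3.1] -/
theorem OrInstance.left_or_right_of_hom [L₁.IsRelational] [L₂.IsRelational]
    [IsEmpty (L₁.Relations 0)] [IsEmpty (L₂.Relations 0)]
    (F : OrInstance B₁ B₂ →[orLanguage L₁ L₂] OrTemplate A₁ A₂) :
    Nonempty (B₁ →[L₁] A₁) ∨ Nonempty (B₂ →[L₂] A₂) := by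
  classical
  by_cases hB₂ : Nonempty B₂
  swap
  · refine Or.inr ⟨⟨fun b => (hB₂ ⟨b⟩).elim, fun {n} g => isEmptyElim g, fun {n} r y => ?_⟩⟩
    cases n with
    | zero => exact isEmptyElim r
    | succ n => exact fun _ => (hB₂ ⟨y 0⟩).elim
  obtain ⟨b₀⟩ := hB₂
  have hlink : ∀ (b₁ : B₁) (b₂ : B₂), RelMap (L := orLanguage L₁ L₂) OrRel.link
      ![F (OrInstance.inl b₁), F (OrInstance.inr b₂)] := by
    intro b₁ b₂
    have h := F.map_rel OrRel.link _ (OrInstance.relMap_link_pair (L₁ := L₁) (L₂ := L₂) b₁ b₂)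
    convert h using 1
    ext i
    fin_cases i <;> rfl
  by_cases hc : ∃ b₁ : B₁, F (OrInstance.inl b₁) = OrTemplate.inl none
  · -- some point of `B₁` escapes to `c₁`: all of `B₂` is mapped into `A₂`
    obtain ⟨b₁, hb₁⟩ := hc
    right
    have hval : ∀ b₂ : B₂, ∃ a : A₂, F (OrInstance.inr b₂) = OrTemplate.inr (some a) := by
      intro b₂
      rcases (OrTemplate.relMap_link _).1 (hlink b₁ b₂) with ⟨a, o, h0, -⟩ | ⟨o, a, -, h1⟩
      · exact absurd (OrTemplate.inl_inj.1 (hb₁.symm.trans h0)) (by simp)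
      · exact ⟨a, h1⟩
    choose g hg using hval
    refine ⟨⟨g, fun {n} f => isEmptyElim f, fun {n} r y hy => ?_⟩⟩
    have h := F.map_rel (OrRel.inr r) _ (OrInstance.relMap_inr_of (L₁ := L₁) r hy)
    refine OrTemplate.relMap_of_relMap_inr_some (L₁ := L₁) (A₁ := A₁) r (g ∘ y) ?_
    convert h using 1
    funext i
    simp [Function.comp, hg (y i)]
  · -- no point of `B₁` escapes: `B₁` is mapped into `A₁`
    left
    have hval : ∀ b₁ : B₁, ∃ a : A₁, F (OrInstance.inl b₁) = OrTemplate.inl (some a) := by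
      intro b₁
      rcases (OrTemplate.relMap_link _).1 (hlink b₁ b₀) with ⟨a, o, h0, -⟩ | ⟨o, a, h0, -⟩
      · exact ⟨a, h0⟩
      · cases o with
        | none => exact absurd ⟨b₁, h0⟩ hc
        | some a => exact ⟨a, h0⟩
    choose g hg using hval
    refine ⟨⟨g, fun {n} f => isEmptyElim f, fun {n} r y hy => ?_⟩⟩
    have h := F.map_rel (OrRel.inl r) _ (OrInstance.relMap_inl_of (L₂ := L₂) r hy)
    refine OrTemplate.relMap_of_relMap_inl_some (L₂ := L₂) (A₂ := A₂) r (g ∘ y) ?_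
    convert h using 1
    funext i
    simp [Function.comp, hg (y i)]

/-- **Lemma 3.1.** `𝔹(𝔹₁,𝔹₂) ∈ CSP(OR_⊥(𝔸₁,𝔸₂))` iff `𝔹₁ ∈ CSP(𝔸₁)` or `𝔹₂ ∈ CSP(𝔸₂)` (relational
vocabularies without `0`-ary symbols). [cite: LichterPago2025, Lemma 3.1] -/
theorem OrInstance.hom_iff [L₁.IsRelational] [L₂.IsRelational]
    [IsEmpty (L₁.Relations 0)] [IsEmpty (L₂.Relations 0)] :
    Nonempty (OrInstance B₁ B₂ →[orLanguage L₁ L₂] OrTemplate A₁ A₂) ↔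
      Nonempty (B₁ →[L₁] A₁) ∨ Nonempty (B₂ →[L₂] A₂) :=
  ⟨fun ⟨F⟩ => OrInstance.left_or_right_of_hom F,
    fun h => h.elim (fun ⟨f⟩ => OrInstance.hom_of_left f) fun ⟨f⟩ => OrInstance.hom_of_right f⟩

end Correctness

end OrConstruction

end Literature.ModelTheory.FiniteModelTheory
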